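import Summits.ABC.IUTFork.Cor312NotPointwiseDHVolIdeles
import HarnessLib

/-!
# [IUTchIII] Cor. 3.12 — the per-packet B-INPUTs are FALSE at EXPLICIT ideles of the sharp Dupuy–Hilado real
# setting, with the `BridgeHyps` binder discharged (proof-only non-vacuity record)

Record-only file (D-0012) of the abc-iut cell (Cor. 3.12 cone, D-0067; seat abc-iut-w5-d096 gen 3, written as the
RQ7 kernel probe of abc-iut-w4-d107's `Cor312NotPointwiseDHVolBInputs` p424156 and lifted into the tree after the
author's first-refusal window). TAKES NO SIDE on [IUTchIII] Cor. 3.12; theorems only, 0 `def`s, no new `Prop` fact,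
no FACT-LIST row consumed.

abc-iut-w4-d107's `settingDHVolSharp_fork_of_ideles_sharp` (`Cor312NotPointwiseDHVolIdeles`, sequel of
`Cor312NotPointwiseDHVolBInputs` p424156 with the `BridgeHyps` binder discharged by abc-iut-c312-3's
`bridgeHyps_settingDHVolSharp_of_ideles`) refutes, at a deep packet `(i₀+1, p)` of the assembled sharp real setting
`Real.settingDHVolSharp`, the PER-PACKET reading and TEAM B's per-packet B-INPUTs `VolumeTransport` /
`VolumeTransportAt m₀` (abc-iut-c312-11 `Cor312LogKummerRoute`) for EVERY choice of pilot ideles subject only to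
norm constraints (non-vanishing, units off `S`, `‖t_{Θ,i₀+1,v}‖ ≤ ρ_q^w`, `‖t_{q,v}‖ ≥ ρ_q`, `ρ_q < ε(X, logv, p, i₀, w)`);
its docstring leaves the EXISTENCE of such ideles to the arithmetic of the pilot data. THIS file records that
existence in the deep-bad-prime shape and the resulting instance:

* `norm_natCast_pow_kOf` — `‖p^k‖ = p^{-k}` in every rescaled completion `K_v`, `v | p`;
* `settingDHVolSharp_bInputs_false_explicit` — NON-VACUITY: for every prime `p` lying under `Supp(q)` (every place of
  `F` over `p` is a bad place of the pilot data — the shape of abc-iut-c312-10's `sharp_deep_ideles_exist`) and every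
  label index `i₀`, the EXPLICIT rational ideles `t_q := p^a`, `t_Θ := p^{2a}` over `p` (`1` elsewhere; `a` large,
  `w = 2`) satisfy every hypothesis, so the per-packet reading fails and `¬ VolumeTransport ∧ ∀ m₀, ¬ VolumeTransportAt m₀`
  hold at an honest instance of `settingDHVolSharp`, for EVERY choice of the Thm 3.11 context binders
  `M archPk archSub Ψ act Mmod region n lat sig split qData`.

HONEST SCOPE (as the parent): these are the STRONGER-THAN-PRINT per-packet readings (ADJUDICATION-SPEC §2 (G1′));
the printed inequality of Cor. 3.12 is GLOBAL (kurims p. 174) and at a deep bad place `P_{Θ,j} = j²·P_q` (Dupuy–Hilado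
(3.4)) makes the per-packet sign pattern the expected one — nothing here bears on Cor. 3.12 as printed, on
`GlobalVolumeTransport` (GAP G-c312-11-1), or on the intended Kummer glue. Classical content: `‖p‖ = p⁻¹` in the
rescaled completions. [claim: Mochizuki2012, status: disputed] [cite: DupuyHilado2025, §3.4, §4.10, §4.12]
[cite: ScholzeStix2018, §2.2 pp. 9–10]
-/

noncomputable section

open Set Function
open scoped Pointwise

namespace Summit.ABC.IUTFork.Thm311.Real

open Cor312 Cor312.Setting Cor312Vol Literature.IUT.LogThetaLattice Literature.IUT.LogVolume

variable {F : Type} [Field F] [NumberField F] (X : PilotData F) {logv : PadicLogs F} (hlog : LogvAnalytic logv)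
  (M : Type) [Field M] [NumberField M]
  (archPk : ∀ (j : (thetaIndex X).Label) (vQ : (thetaIndex X).VQ), Set ((logShellsDH X logv).Packet j vQ))
  (archSub : ∀ (j : (thetaIndex X).Label) (v : (thetaIndex X).V),
    Set ((logShellsDH X logv).Packet j ((thetaIndex X).over v)))
  (Ψ : ℤ → ∀ v : (thetaIndex X).V, v ∈ (thetaIndex X).Vbad → Set ((logShellsDH X logv).StarPacket v))
  (act : ℤ → ∀ v : (thetaIndex X).V, v ∈ (thetaIndex X).Vbad →
    (logShellsDH X logv).StarPacket v → Module.End ℚ ((logShellsDH X logv).StarPacket v))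
  (Mmod : ℤ → ∀ j : (thetaIndex X).LabelStar, Set ((logShellsDH X logv).GlobalPacket j.1))
  (region : ℤ → ∀ j : (thetaIndex X).LabelStar, FinDivisor M → ∀ vQ : (thetaIndex X).VQ,
    Set ((logShellsDH X logv).Packet j.1 vQ))
  (n : ℤ) {HT : Type} {LogLink : HT → HT → Type} {IsFull : ∀ {s t : HT}, LogLink s t → Prop}
  (lat : LGPGaussianLogThetaLattice LogLink IsFull)
  {Frd : Type} {IsoF : Frd → Frd → Type} {Ob : Frd → Type} {realify : Frd → Frd} {Strip : Type}
  {IsoS : Strip → Strip → Type} {Mv : ∀ v : (thetaIndex X).V, v ∈ (thetaIndex X).Vbad → Type}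
  [∀ v h, Monoid (Mv v h)]
  (sig : GlobalLGPFrobenioidSignature (thetaIndex X).lstar (thetaIndex X).V (· ∈ (thetaIndex X).Vbad)
    Frd IsoF Ob realify Strip IsoS Mv)
  (split : SplittingMonoids Mv) {ObΔ : Type} {N : ∀ v : (thetaIndex X).V, v ∈ (thetaIndex X).Vbad → Type}
  [∀ v h, Monoid (N v h)] (qData : QPilotData ObΔ N)

/-- `‖p^k‖ = (p⁻¹)^k` in every rescaled completion `K_v`, `v | p` (`RescaledCompletion.norm_algebraMap` +
`Padic.norm_p`). [folklore] -/
theorem norm_natCast_pow_kOf (pp : Nat.Primes) (x : (thetaIndex X).Fibre (.inr pp)) (k : ℕ) :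
    haveI : Fact (pp : ℕ).Prime := ⟨pp.2⟩
    ‖((pp : ℕ) : kOf X pp.1 x) ^ k‖ = (((pp : ℕ) : ℝ)⁻¹) ^ k := by
  haveI : Fact (pp : ℕ).Prime := ⟨pp.2⟩
  rw [norm_pow, show ((pp : ℕ) : kOf X pp.1 x) = algebraMap ℚ_[pp] (kOf X pp.1 x) ((pp : ℕ) : ℚ_[pp]) from
      (map_natCast (algebraMap ℚ_[pp] (kOf X pp.1 x)) (pp : ℕ)).symm,
    Literature.NumberTheory.NumberFields.RescaledCompletion.norm_algebraMap, Padic.norm_p]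

/-- **NON-VACUITY at EXPLICIT ideles**: at a prime `p` all of whose places are bad places of the pilot data (`p` under
`Supp(q)`), the rational ideles `t_q := p^a` over `p` (`1` elsewhere) and `t_Θ := p^{2a}` over `p` (`1` elsewhere),
for `a` large, satisfy every hypothesis of abc-iut-w4-d107's `settingDHVolSharp_fork_of_ideles_sharp` (with
`w = 2`): the per-packet reading and the per-packet B-INPUTs are FALSE at this honest instance of `settingDHVolSharp`, for EVERY choice of the
context binders `M archPk archSub Ψ act Mmod region n lat sig split qData`. STRONGER-THAN-PRINT readings only.
[claim: Mochizuki2012, status: disputed] [cite: DupuyHilado2025, §3.4, §4.10] -/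
theorem settingDHVolSharp_bInputs_false_explicit (pp : Nat.Primes)
    (hSp : ∀ x : (thetaIndex X).Fibre (.inr pp), haveI : Fact (pp : ℕ).Prime := ⟨pp.2⟩; placeOf X pp.1 x ∈ X.S)
    (i₀ : Fin (thetaIndex X).lstar) :
    ∃ (tq : ∀ (pp : Nat.Primes) (x : (thetaIndex X).Fibre (.inr pp)), haveI : Fact (pp : ℕ).Prime := ⟨pp.2⟩; kOf X pp.1 x)
      (t : ∀ (pp : Nat.Primes) (_ : Fin X.lstar) (x : (thetaIndex X).Fibre (.inr pp)),
        haveI : Fact (pp : ℕ).Prime := ⟨pp.2⟩; kOf X pp.1 x)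
      (htq0 : ∀ pp x, tq pp x ≠ 0)
      (htq1 : ∀ (pp : Nat.Primes) (x : (thetaIndex X).Fibre (.inr pp)),
        haveI : Fact (pp : ℕ).Prime := ⟨pp.2⟩; placeOf X pp.1 x ∉ X.S → ‖tq pp x‖ = 1),
      (¬ ∀ (i : Fin (thetaIndex X).lstar) (vQ : (thetaIndex X).VQ),
          (settingDHVolSharp X hlog M archPk archSub Ψ act Mmod region n lat sig split qData tq t htq0
              htq1).qLocal (labelSucc i) vQ ≤
            ((settingDHVolSharp X hlog M archPk archSub Ψ act Mmod region n lat sig split qData tq t htq0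
              htq1).thetaLocal (labelSucc i) vQ).untopD 0) ∧
      ¬ VolumeTransport (settingDHVolSharp X hlog M archPk archSub Ψ act Mmod region n lat sig split qData tq t
          htq0 htq1) ∧
      ∀ m₀ : ℤ, ¬ VolumeTransportAt (settingDHVolSharp X hlog M archPk archSub Ψ act Mmod region n lat sig split
          qData tq t htq0 htq1) m₀ := by
  classical
  haveI : Fact (pp : ℕ).Prime := ⟨pp.2⟩
  obtain ⟨ε, hε, h⟩ := settingDHVolSharp_fork_of_ideles_sharp X hlog M archPk archSub Ψ act Mmod region n lat sig split qData pp
    i₀ (w := 2) one_lt_two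
  have hp1 : (1 : ℝ) < (pp : ℕ) := by exact_mod_cast (Fact.out : (pp : ℕ).Prime).one_lt
  have hp0 : (0 : ℝ) < (pp : ℕ) := zero_lt_one.trans hp1
  have hpinv0 : (0 : ℝ) < ((pp : ℕ) : ℝ)⁻¹ := inv_pos.mpr hp0
  have hpinv1 : ((pp : ℕ) : ℝ)⁻¹ < 1 := inv_lt_one_of_one_lt₀ hp1
  obtain ⟨a, ha⟩ := exists_pow_lt_of_lt_one hε hpinv1
  -- the explicit ideles
  let tq : ∀ (pp' : Nat.Primes) (x : (thetaIndex X).Fibre (.inr pp')),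
      haveI : Fact (pp' : ℕ).Prime := ⟨pp'.2⟩; kOf X pp'.1 x :=
    fun pp' x => haveI : Fact (pp' : ℕ).Prime := ⟨pp'.2⟩
      ((pp' : ℕ) : kOf X pp'.1 x) ^ (if pp' = pp then a else 0)
  let t : ∀ (pp' : Nat.Primes) (_ : Fin X.lstar) (x : (thetaIndex X).Fibre (.inr pp')),
      haveI : Fact (pp' : ℕ).Prime := ⟨pp'.2⟩; kOf X pp'.1 x :=
    fun pp' _ x => haveI : Fact (pp' : ℕ).Prime := ⟨pp'.2⟩
      ((pp' : ℕ) : kOf X pp'.1 x) ^ (if pp' = pp then 2 * a else 0)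
  have hne : ∀ (pp' : Nat.Primes) (x : (thetaIndex X).Fibre (.inr pp')) (k : ℕ),
      haveI : Fact (pp' : ℕ).Prime := ⟨pp'.2⟩; ((pp' : ℕ) : kOf X pp'.1 x) ^ k ≠ 0 := by
    intro pp' x k
    haveI : Fact (pp' : ℕ).Prime := ⟨pp'.2⟩
    haveI : CharZero (kOf X pp'.1 x) :=
      charZero_of_injective_algebraMap (algebraMap ℚ_[pp'] (kOf X pp'.1 x)).injective
    exact pow_ne_zero _ (Nat.cast_ne_zero.mpr (Fact.out : (pp' : ℕ).Prime).ne_zero)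
  have htq0 : ∀ pp' x, tq pp' x ≠ 0 := fun pp' x => hne pp' x _
  have ht0 : ∀ pp' i x, t pp' i x ≠ 0 := fun pp' _ x => hne pp' x _
  have hoff : ∀ (pp' : Nat.Primes) (x : (thetaIndex X).Fibre (.inr pp')),
      haveI : Fact (pp' : ℕ).Prime := ⟨pp'.2⟩; placeOf X pp'.1 x ∉ X.S → pp' ≠ pp := by
    intro pp' x hx hpp
    subst hpp
    exact hx (hSp x)
  have htq1 : ∀ (pp' : Nat.Primes) (x : (thetaIndex X).Fibre (.inr pp')),
      haveI : Fact (pp' : ℕ).Prime := ⟨pp'.2⟩; placeOf X pp'.1 x ∉ X.S → ‖tq pp' x‖ = 1 := by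
    intro pp' x hx
    haveI : Fact (pp' : ℕ).Prime := ⟨pp'.2⟩
    show ‖((pp' : ℕ) : kOf X pp'.1 x) ^ (if pp' = pp then a else 0)‖ = 1
    rw [if_neg (hoff pp' x hx), pow_zero, norm_one]
  have ht1 : ∀ (pp' : Nat.Primes) (i : Fin X.lstar) (x : (thetaIndex X).Fibre (.inr pp')),
      haveI : Fact (pp' : ℕ).Prime := ⟨pp'.2⟩; placeOf X pp'.1 x ∉ X.S → ‖t pp' i x‖ = 1 := by
    intro pp' i x hx
    haveI : Fact (pp' : ℕ).Prime := ⟨pp'.2⟩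
    show ‖((pp' : ℕ) : kOf X pp'.1 x) ^ (if pp' = pp then 2 * a else 0)‖ = 1
    rw [if_neg (hoff pp' x hx), pow_zero, norm_one]
  refine ⟨tq, t, htq0, htq1, ?_⟩
  refine h tq t ht0 ht1 htq0 htq1 ((((pp : ℕ) : ℝ)⁻¹) ^ a) (pow_pos hpinv0 a) ha ?_ ?_
  · intro x
    show ‖((pp : ℕ) : kOf X pp.1 x) ^ (if pp = pp then 2 * a else 0)‖ ≤ _
    rw [if_pos rfl, norm_natCast_pow_kOf, Real.rpow_two, ← pow_mul, mul_comm]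
  · intro x
    show _ ≤ ‖((pp : ℕ) : kOf X pp.1 x) ^ (if pp = pp then a else 0)‖
    rw [if_pos rfl, norm_natCast_pow_kOf]

end Summit.ABC.IUTFork.Thm311.Real

end
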